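import Mathlib
import HarnessLib
import Summits.Ventures.LatticeQCDFlow.Exactness.IMHMixingWindow

/-!
# Exactness — worst-case mixing of independence samplers is ordered by the normalised weight at a common mode

HONEST FRAMING: exact (Metropolis-corrected) sampling algorithms for lattice gauge theory;
figures of merit are autocorrelation/cost numbers at stated couplings and volumes; no
continuum-physics claim.

Venture `LatticeQCDFlow` (cell pub-lqcd), topic `Exactness`, FANOUT row 30 (lean-1, GEN-28) — OUR WORK, the
abstract layer under `Scaling/AutoregressiveGaugeMixingDominance`.  Two independence Metropolis samplers
`K_i = indepMH q_i w_i` (`w_i > 0` measurable, `π_i = w_i·q_i` probability laws) with a COMMON mode `x₀`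
(`w_i ≤ w_i(x₀)`); recall `A_i(x₀) = 1/w_i(x₀)` and the worst-case profile `(1 − 1/w_i(x₀))^t`
(`IMHModeRateSharp`, `IMHMixingWindow`).

* **`indepMH_mixed_mono`** — if `x₀` is `q₁`-atom-free and `w₂(x₀) ≤ w₁(x₀)`, then for every `t` and `ε`:
  whenever every start and event of `K₁` are `ε`-close to `π₁` at time `t`, every start and event of `K₂` are
  `ε`-close to `π₂` at time `t` — the sampler with the smaller normalised weight at the mode (the larger
  acceptance mass there) is never slower in worst case;
* **`exists_mixed_not_mixed_of_lt`** — if moreover `x₀` is `q₂`-atom-free and `w₂(x₀) < w₁(x₀)`, then at every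
  time `t ≥ 1` some `ε` (namely `(1 − 1/w₂(x₀))^t`) separates them: `K₂` is `ε`-mixed from every start, `K₁`
  is not.

The targets `π₁`, `π₂` need not coincide (in the gauge application they do).  No `def`, no `sorry`, nothing
cited as a fact; general measurable space with measurable singletons.
-/

noncomputable section

namespace Summit.Ventures.LatticeQCDFlow.Exactness

open MeasureTheory ProbabilityTheory Function
open scoped ENNReal

variable {Ω : Type*} [MeasurableSpace Ω] [MeasurableSingletonClass Ω]
variable {q₁ q₂ : Measure Ω} [IsProbabilityMeasure q₁] [IsProbabilityMeasure q₂] {w₁ w₂ : Ω → ℝ}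

/-- **WORST-CASE MIXING IS MONOTONE IN THE NORMALISED WEIGHT AT A COMMON MODE.** [ours] -/
theorem indepMH_mixed_mono (hw₁ : Measurable w₁) (hw₁0 : ∀ y, 0 < w₁ y) (hw₂ : Measurable w₂)
    (hw₂0 : ∀ y, 0 < w₂ y) {x₀ : Ω} (hmax₁ : ∀ y, w₁ y ≤ w₁ x₀) (hmax₂ : ∀ y, w₂ y ≤ w₂ x₀)
    (hq₁x : q₁ {x₀} = 0) (hle : w₂ x₀ ≤ w₁ x₀)
    [IsProbabilityMeasure (q₁.withDensity fun y => ENNReal.ofReal (w₁ y))]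
    [IsProbabilityMeasure (q₂.withDensity fun y => ENNReal.ofReal (w₂ y))] (t : ℕ) (ε : ℝ)
    (h : ∀ (μ : Measure Ω) [IsProbabilityMeasure μ] (A : Set Ω),
      |((fun m : Measure Ω => m.bind (indepMH q₁ w₁))^[t] μ).real A -
        (q₁.withDensity fun y => ENNReal.ofReal (w₁ y)).real A| ≤ ε)
    (μ : Measure Ω) [IsProbabilityMeasure μ] (A : Set Ω) :
    |((fun m : Measure Ω => m.bind (indepMH q₂ w₂))^[t] μ).real A -
        (q₂.withDensity fun y => ENNReal.ofReal (w₂ y)).real A| ≤ ε := by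
  have h1 := (indepMH_worstCase_le_iff hw₁ hw₁0 hmax₁ hq₁x t ε).1 h
  have hone₂ : 1 ≤ w₂ x₀ := one_le_of_mode (q := q₂) hmax₂
  have h0 : 0 ≤ 1 - (w₂ x₀)⁻¹ := sub_nonneg.2 (inv_le_one_of_one_le₀ hone₂)
  have hinv : (w₁ x₀)⁻¹ ≤ (w₂ x₀)⁻¹ := inv_anti₀ (zero_lt_one.trans_le hone₂) hle
  exact (indepMH_uniform_rate_of_mode hw₂ hw₂0 hmax₂ μ t A).trans
    ((pow_le_pow_left₀ h0 (by linarith) t).trans h1)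

/-- **STRICT SEPARATION AT EVERY POSITIVE TIME** when `w₂(x₀) < w₁(x₀)` (both atom-free at `x₀`). [ours] -/
theorem exists_mixed_not_mixed_of_lt (hw₁ : Measurable w₁) (hw₁0 : ∀ y, 0 < w₁ y) (hw₂ : Measurable w₂)
    (hw₂0 : ∀ y, 0 < w₂ y) {x₀ : Ω} (hmax₁ : ∀ y, w₁ y ≤ w₁ x₀) (hmax₂ : ∀ y, w₂ y ≤ w₂ x₀)
    (hq₁x : q₁ {x₀} = 0) (hq₂x : q₂ {x₀} = 0) (hlt : w₂ x₀ < w₁ x₀)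
    [IsProbabilityMeasure (q₁.withDensity fun y => ENNReal.ofReal (w₁ y))]
    [IsProbabilityMeasure (q₂.withDensity fun y => ENNReal.ofReal (w₂ y))] {t : ℕ} (ht : t ≠ 0) :
    ∃ ε : ℝ,
      (∀ (μ : Measure Ω) [IsProbabilityMeasure μ] (A : Set Ω),
        |((fun m : Measure Ω => m.bind (indepMH q₂ w₂))^[t] μ).real A -
          (q₂.withDensity fun y => ENNReal.ofReal (w₂ y)).real A| ≤ ε) ∧
      ¬ (∀ (μ : Measure Ω) [IsProbabilityMeasure μ] (A : Set Ω),
        |((fun m : Measure Ω => m.bind (indepMH q₁ w₁))^[t] μ).real A -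
          (q₁.withDensity fun y => ENNReal.ofReal (w₁ y)).real A| ≤ ε) := by
  refine ⟨(1 - (w₂ x₀)⁻¹) ^ t, (indepMH_worstCase_le_iff hw₂ hw₂0 hmax₂ hq₂x t _).2 le_rfl, fun h => ?_⟩
  have h1 := (indepMH_worstCase_le_iff hw₁ hw₁0 hmax₁ hq₁x t _).1 h
  have hone₂ : 1 ≤ w₂ x₀ := one_le_of_mode (q := q₂) hmax₂
  have h0 : 0 ≤ 1 - (w₂ x₀)⁻¹ := sub_nonneg.2 (inv_le_one_of_one_le₀ hone₂)
  have hinv : (w₁ x₀)⁻¹ < (w₂ x₀)⁻¹ := inv_strictAnti₀ (zero_lt_one.trans_le hone₂) hlt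
  exact absurd h1 (not_le.2 (pow_lt_pow_left₀ (by linarith) h0 ht))

end Summit.Ventures.LatticeQCDFlow.Exactness

end
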